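import Summits.Parity.GeneralizedHardyLittlewood.Theorems.PolymathEpsThreeCeilingGridBoundHighRankActivityFiveAssembly

/-!
# Route `PolymathEpsThreeCeiling`, crux `GridBoundHigh` (stmt-Parity-19069): the degenerate-fibre inequality discharged —
# the five-constant certificate from ONE real inequality

`RankActivity.fiveBudget₀_le_one`: the degenerate fibre budget `fiveBudget₀ ε Λ c s₀` (outer pair `(s₀, 0)`) is at most
`1` on `0 < s₀ ≤ 1 - ε` as soon as the two ENDPOINT values are: `(1-ε)/c + 2ε/Λ ≤ 1` and `(1-ε)/(Λ-c) + (3ε-1)/Λ ≤ 1`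
(it is dominated by a function linear in `s₀`).  Hence (`RankActivity.cwCert_of_fiveBudget₁`) the body of
`stub_cwCertsHigh` at `(ε, Λ)` follows from ELEVEN numeric side conditions on the five constants and the single
two-variable real inequality
`(R1)  fiveBudget ε Λ β d₁₀ d₀ c s₀ s₁ ≤ 1` for `0 < s₁ ≤ s₀`, `s₀ + s₁ ≤ 1 - ε`
(three logarithms of affine ratios plus three linear terms, `…FiveBudget.lean`).  For the 24 tabulated constant sets
(item evidence `PARAMS-19069-rankactivity-5const.md`) all eleven side conditions hold and `max R1-LHS = 0.97473 (j=17) …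
0.99047 (j=40)` numerically (`fivebudget_check.py`, evidence census §F8); proving (R1) is all that remains of the crux
along this line.  Support lemmas for stmt-Parity-19069 only; no summit claim.  Standard axioms.
-/

noncomputable section

open Finset MeasureTheory Set Filter

namespace Summit.Parity.GeneralizedHardyLittlewood.Theses.PolymathEpsThreeCeiling

namespace RankActivity

/-- **Degenerate fibres are cheap**: `fiveBudget₀ ≤ 1` from its two endpoint values. -/
theorem fiveBudget₀_le_one {ε Λ c s₀ : ℝ} (hΛ : 0 < Λ) (hc1 : Λ / 2 ≤ c) (hc2 : c < Λ)
    (hs0 : 0 < s₀) (hs0η : s₀ ≤ 1 - ε)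
    (R2a : (1 - ε) / c + 2 * ε / Λ ≤ 1) (R2b : (1 - ε) / (Λ - c) + (3 * ε - 1) / Λ ≤ 1) :
    fiveBudget₀ ε Λ c s₀ ≤ 1 := by
  set L := 1 + ε - s₀ with hL
  set e := min (1 - ε) L with he
  set m := min s₀ e with hm
  have hB : fiveBudget₀ ε Λ c s₀ = m / (Λ - c) + (e - m) / c + (L - e) / Λ := rfl
  have hcpos : 0 < c := by linarith
  have hdpos : 0 < Λ - c := by linarith
  have hme : m ≤ e := min_le_right _ _
  have hms : m ≤ s₀ := min_le_left _ _
  have heη : e ≤ 1 - ε := min_le_left _ _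
  -- rewrite as a combination with nonnegative coefficients
  have e1 : m / (Λ - c) + (e - m) / c + (L - e) / Λ =
      m * (1 / (Λ - c) - 1 / c) + e * (1 / c - 1 / Λ) + L / Λ := by ring
  have hA : 0 ≤ 1 / (Λ - c) - 1 / c := by
    rw [sub_nonneg]; exact one_div_le_one_div_of_le hdpos (by linarith)
  have hBc : 0 ≤ 1 / c - 1 / Λ := by
    rw [sub_nonneg]; exact one_div_le_one_div_of_le hcpos hc2.le
  have step : fiveBudget₀ ε Λ c s₀ ≤ s₀ * (1 / (Λ - c) - 1 / c) + (1 - ε) * (1 / c - 1 / Λ) + L / Λ := by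
    rw [hB, e1]
    have t1 := mul_le_mul_of_nonneg_right hms hA
    have t2 := mul_le_mul_of_nonneg_right heη hBc
    linarith
  -- the right-hand side is affine in `s₀`; its values at `s₀ = 0` and `s₀ = 1 - ε` are `R2a`, `R2b`
  have v0 : (0:ℝ) * (1 / (Λ - c) - 1 / c) + (1 - ε) * (1 / c - 1 / Λ) + (1 + ε - 0) / Λ =
      (1 - ε) / c + 2 * ε / Λ := by field_simp; ring
  have v1 : (1 - ε) * (1 / (Λ - c) - 1 / c) + (1 - ε) * (1 / c - 1 / Λ) + (1 + ε - (1 - ε)) / Λ =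
      (1 - ε) / (Λ - c) + (3 * ε - 1) / Λ := by field_simp; ring
  -- convexity (linearity) in `s₀`
  set A := 1 / (Λ - c) - 1 / c - 1 / Λ with hAdef
  have lin : ∀ x : ℝ, x * (1 / (Λ - c) - 1 / c) + (1 - ε) * (1 / c - 1 / Λ) + (1 + ε - x) / Λ =
      ((1 - ε) / c + 2 * ε / Λ) + x * A := by
    intro x; rw [hAdef]; field_simp; ring
  rw [hL] at step
  rw [lin] at step
  have hη0 : 0 < 1 - ε := hs0.trans_le hs0η
  have end1 : ((1 - ε) / c + 2 * ε / Λ) + (1 - ε) * A ≤ 1 := by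
    have := lin (1 - ε); rw [v1] at this; linarith
  rcases le_or_gt 0 A with hA0 | hA0
  · have : s₀ * A ≤ (1 - ε) * A := mul_le_mul_of_nonneg_right hs0η hA0
    linarith
  · have : s₀ * A ≤ 0 := mul_nonpos_iff.2 (Or.inl ⟨hs0.le, hA0.le⟩)
    linarith

/-- **The five-constant certificate from ONE real inequality (R1).** -/
theorem cwCert_of_fiveBudget₁ {ε Λ β d₁₀ d₀ c : ℝ} (hε : 1 / 5 ≤ ε) (hε1 : ε < 1) (hΛ : 0 < Λ)
    (hc1 : Λ / 2 ≤ c) (hc2 : c < Λ) (hd1 : 0 ≤ d₁₀) (hd0 : 0 ≤ d₀) (hβ : 0 < β)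
    (hBM : 0 < 2 * β - d₁₀ / fiveS ε) (h1 : 2 * d₁₀ + d₀ < Λ)
    (h2 : β * (3 * (1 - ε) / 2) + 2 * (d₁₀ * (1 - (3 * (1 - ε) / 2) / fiveS ε)) + d₀ < Λ)
    (hT : 1 + ε ≤ Λ) (R2a : (1 - ε) / c + 2 * ε / Λ ≤ 1) (R2b : (1 - ε) / (Λ - c) + (3 * ε - 1) / Λ ≤ 1)
    (R1 : ∀ s₀ s₁ : ℝ, 0 < s₁ → s₁ ≤ s₀ → s₀ + s₁ ≤ 1 - ε → fiveBudget ε Λ β d₁₀ d₀ c s₀ s₁ ≤ 1) :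
    ∃ w : Fin 3 → (Fin 3 → ℝ) → ℝ, (∀ m, Measurable (w m)) ∧
      (∀ m (t : Fin 3 → ℝ), 0 < t m → ∑ i ∈ univ.erase m, t i ≤ 1 - ε → 0 < w m t) ∧
      (∀ m (s : Fin 2 → ℝ), (∀ i, 0 ≤ s i) → ∑ i, s i ≤ 1 - ε →
        ∫⁻ u in Ioc (0:ℝ) (1 + ε - ∑ i, s i), ENNReal.ofReal (w m (Fin.insertNth m u s))⁻¹ ≤ 1) ∧
      (∀ t : Fin 3 → ℝ, (∀ i, 0 ≤ t i) → ∑ i, t i ≤ 1 + ε →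
        ∑ m, (if 0 < t m ∧ ∑ i ∈ univ.erase m, t i ≤ 1 - ε then w m t else 0) ≤ Λ) :=
  cwCert_of_fiveBudget hε hε1 hΛ hc1 hc2 hd1 hd0 hβ hBM h1 h2 hT R1
    (fun _ hs0 hs0η => fiveBudget₀_le_one hΛ hc1 hc2 hs0 hs0η R2a R2b)

end RankActivity

end Summit.Parity.GeneralizedHardyLittlewood.Theses.PolymathEpsThreeCeiling

end
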